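import Summits.Ventures.YMGap.RobustBall.OneStateInvariantPairs
import Summits.Ventures.YMGap.RobustBall.ShapeLoopFamily
import HarnessLib

/-!
# Venture YMGap, track ROBUST-BALL — ONE STATE, step 12: TRANSLATION-INVARIANT LOOP ACTIONS are translation
# covariant — the one state of a generalized Wilson action `∑_{x,s} c_s Re tr U_{x + γ_s}/N` is translation invariant

HONEST FRAMING. WHAT THIS IS: a venture file (cell `pub-ymgap`, track Y2 ROBUST-BALL, seat ds-3) checking the
translation covariance hypothesis `W_{X+v}(θ_v U) = W_X(U)` for rb-p1's loop-family actions built from SHAPES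
TRANSLATED EVERYWHERE (`loopFamilyAction N (shapeLoop σ) (c₀ ∘ snd)`, `ShapeLoopFamily.lean`: index `(x, s)`, the
closed shape `σ s` carried to the base point `x`, coupling `c₀ s` depending on the shape only):
* holonomies are covariant: `hol_{θ_{-a} U}(w) = hol_U(w + a)` (`walkHolonomy_map_shift`, from rb-p1's
  `dartStep_mapDart_shift`; the composition rule `θ_a θ_b = θ_{a+b}` is the tree's
  `CurvatureKernel.LatticeWindow.configShift_configShift`, inlined here), hence `loopTerm` of a translated walk is the
  loop term in the back-translated field (`loopTerm_map_shift`) and the terms of the translated family are covariant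
  (`loopTerm_shapeLoop_shift`);
* the carrier fibres translate (`mem_carrierFib_shapeLoop_map_iff`), so by `indexedPotential_shift` the whole
  potential is covariant (`loopFamilyAction_shapeLoop_shift`) — for EVERY shape family with finite shape fibres and
  nontrivial shapes;
* CELLS (tier 2, hypothesis-free by name): `SU(2)` on `ℤ⁴` at `β_W = 1/16` plus ALL closed-trail shapes translated
  everywhere with shape couplings `∑_s |c₀ s| |s|² 4^{|s|} ≤ 0.143`: the unique DLR state is TRANSLATION INVARIANT
  (`su2_trailShapes_oneState_translationInvariant`, rb-p1's `su2_trailShapes_massGapS_1_16`); every `N ≥ 2` at 't Hooft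
  `1/64` with `∑_s |c₀ s| |s|² (36/25)^{|s|} ≤ 1/40` (`suN_trailShapes_oneState_translationInvariant`).
WHAT THIS IS NOT: lattice strong-coupling statements; nothing about the continuum limit or the Clay Millennium
problem.

References: H.-O. Georgii (2011), §5.1; the track's `LoopObservable.lean`, `WalkTranslation.lean`,
`LoopActionMember.lean`, `ShapeLoopFamily.lean`, `OneStateInvariant(Pairs).lean`.
-/

noncomputable section

open MeasureTheory Filter Function Finset SimpleGraph
open Literature.Probability.LatticeModels hiding configShift configShift_apply
open Literature.MathematicalPhysics.QuantumLattice
open Literature.MathematicalPhysics.QuantumFieldTheory (walkEdges)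

namespace Summit.Ventures.YMGap.RobustBall

variable {d N : ℕ}

/-! ### Holonomies of translated walks -/

section Holonomy

variable {G : Type*} [Group G] [MeasurableSpace G]

/-- The holonomy of a translated dart is the holonomy of the dart in the back-translated configuration. [folklore] -/
theorem dartHolonomy_mapDart_shift (a : Site d) (U : LGConfig d G) (e : (zdGraph d).Dart) :
    dartHolonomy U ((zdGraphShiftIso a).toEmbedding.toHom.mapDart e) = dartHolonomy (configShift (-a) U) e := by
  simp only [dartHolonomy, dartStep_mapDart_shift, Literature.MathematicalPhysics.QuantumLattice.configShift_apply,
    sub_neg_eq_add]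

/-- **Holonomies are translation covariant**: `hol_U(w + a) = hol_{θ_{-a} U}(w)`. [folklore] -/
theorem walkHolonomy_map_shift (a : Site d) (U : LGConfig d G) {x y : Site d} (w : (zdGraph d).Walk x y) :
    walkHolonomy U (w.map (zdGraphShiftIso a).toEmbedding.toHom) = walkHolonomy (configShift (-a) U) w := by
  induction w with
  | nil => simp [walkHolonomy]
  | cons h w ih =>
    rw [Walk.map_cons, walkHolonomy_cons, walkHolonomy_cons, ih]
    congr 1
    exact dartHolonomy_mapDart_shift a U ⟨(_, _), h⟩

end Holonomy

/-! ### Loop terms of translated shapes -/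

/-- **The loop term of a translated walk is the loop term in the back-translated field.** [folklore] -/
theorem loopTerm_map_shift (c : ℝ) (a : Site d) {x : Site d} (w : (zdGraph d).Walk x x) (U : LGConfig d (SUN N)) :
    loopTerm N c (w.map (zdGraphShiftIso a).toEmbedding.toHom) U = loopTerm N c w (configShift (-a) U) := by
  rw [loopTerm_apply, loopTerm_apply, walkHolonomy_map_shift]

variable {S : Type*} (σ : S → (zdGraph d).Walk (0 : Site d) 0)

/-- **The terms of a translated shape family are translation covariant**: the term of shape `s` at `x + v` in the
field `θ_v U` is the term of shape `s` at `x` in `U`. [folklore] -/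
theorem loopTerm_shapeLoop_shift (c : ℝ) (v : Site d) (i : Site d × S) (U : LGConfig d (SUN N)) :
    loopTerm N c (shapeLoop σ (i.1 + v, i.2)).walk (configShift v U) = loopTerm N c (shapeLoop σ i).walk U := by
  show loopTerm N c ((σ i.2).map (zdGraphShiftIso (i.1 + v)).toEmbedding.toHom) (configShift v U) =
    loopTerm N c ((σ i.2).map (zdGraphShiftIso i.1).toEmbedding.toHom) U
  -- `θ_{-(x+v)} ∘ θ_v = θ_{-x}` (composition of lattice translations)
  have hcomp : configShift (-(i.1 + v)) (configShift v U) = configShift (-i.1) U := by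
    funext e
    simp only [Literature.MathematicalPhysics.QuantumLattice.configShift_apply]
    exact congrArg U (Prod.ext (by abel) rfl)
  rw [loopTerm_map_shift, loopTerm_map_shift, hcomp]

/-- The links of the shape at `x + v` are the translated links of the shape at `x`. [folklore] -/
theorem walkEdges_shapeLoop_shift (v : Site d) (i : Site d × S) :
    walkEdges (shapeLoop σ (i.1 + v, i.2)).walk = (walkEdges (shapeLoop σ i).walk).map (edgeShift v).toEmbedding := by
  rw [walkEdges_shapeLoop, walkEdges_shapeLoop, Finset.map_eq_image, Finset.image_image]
  refine Finset.image_congr fun e _ => ?_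
  simp only [Function.comp_apply, Equiv.coe_toEmbedding, edgeShift_apply, add_assoc]

/-- **The carrier fibre of a translated link set consists of the translated indices** (finite shape fibres,
nontrivial shapes). [folklore] -/
theorem mem_carrierFib_shapeLoop_map_iff (hσ : ∀ Y : Finset (ZdEdge d), {s | walkEdges (σ s) = Y}.Finite)
    (hpos : ∀ s, 0 < (σ s).length) (v : Site d) (X : Finset (ZdEdge d)) (i : Site d × S) :
    i ∈ carrierFib (fun i => walkEdges (shapeLoop σ i).walk) (X.map (edgeShift v).toEmbedding) ↔
      ∃ j ∈ carrierFib (fun i => walkEdges (shapeLoop σ i).walk) X, (j.1 + v, j.2) = i := by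
  have hfin := finite_fibre_shapeLoop σ hσ hpos
  rw [mem_carrierFib hfin]
  constructor
  · intro h
    refine ⟨(i.1 + -v, i.2), ?_, by simp⟩
    rw [mem_carrierFib hfin, walkEdges_shapeLoop_shift σ (-v) i, h, map_edgeShift_map_neg]
  · rintro ⟨j, hj, rfl⟩
    rw [mem_carrierFib hfin] at hj
    rw [walkEdges_shapeLoop_shift, hj]

/-- ★ **TRANSLATION-INVARIANT LOOP ACTIONS ARE TRANSLATION COVARIANT**: for every shape family `σ` with finite shape
fibres and nontrivial shapes and every shape coupling `c₀`,
`W_{X+v}(θ_v U) = W_X(U)` for `W = loopFamilyAction N (shapeLoop σ) (c₀ ∘ snd)`. [folklore] -/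
theorem loopFamilyAction_shapeLoop_shift (hσ : ∀ Y : Finset (ZdEdge d), {s | walkEdges (σ s) = Y}.Finite)
    (hpos : ∀ s, 0 < (σ s).length) (c₀ : S → ℝ) (v : Site d) (X : Finset (ZdEdge d)) (U : LGConfig d (SUN N)) :
    loopFamilyAction N (shapeLoop σ) (fun i => c₀ i.2) (X.map (edgeShift v).toEmbedding) (configShift v U) =
      loopFamilyAction N (shapeLoop σ) (fun i => c₀ i.2) X U := by
  unfold loopFamilyAction
  refine indexedPotential_shift (fun v i => (i.1 + v, i.2)) (fun v X i => mem_carrierFib_shapeLoop_map_iff σ hσ hpos v X i)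
    (fun v j k h => ?_) (fun v i U => loopTerm_shapeLoop_shift σ (c₀ i.2) v i U) v X U
  simp only [Prod.mk.injEq, add_left_inj] at h
  exact Prod.ext h.1 h.2

/-! ### Cells: all closed-trail shapes translated everywhere -/

section Cells

/-- ★★ **`SU(2)`, `ℤ⁴`, `β_W = 1/16` + ALL CLOSED-TRAIL SHAPES translated everywhere, `∑_s |c₀ s| |s|² 4^{|s|} ≤ 0.143`
(TIER 2, arbitrarily long loops): ONE DLR STATE, TRANSLATION INVARIANT** (rb-p1's `su2_trailShapes_massGapS_1_16`).
[folklore] -/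
theorem su2_trailShapes_oneState_translationInvariant {c₀ : TrailShape 4 → ℝ}
    (hsum : Summable fun s => |c₀ s| * (trailShape s).length ^ 2 * (4 : ℝ) ^ (trailShape s).length)
    (hε : ∑' s, |c₀ s| * (trailShape s).length ^ 2 * (4 : ℝ) ^ (trailShape s).length ≤ 143 / 1000) :
    ∃ μ : Measure (LGConfig 4 (SUN 2)),
      perturbedGibbsMeasuresS (d := 4) (fundamentalRep (Fin 2)) (((2 : ℕ) : ℝ) * ((1 / 16 : ℝ) / 4))
          (loopFamilyAction (d := 4) 2 (shapeLoop trailShape) fun i => c₀ i.2) = {μ} ∧ IsZdTranslationInvariant μ := by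
  have hexp : ∀ s : TrailShape 4, Real.exp (Real.log 2 * (2 * ((trailShape s).length : ℝ))) = (4 : ℝ) ^ (trailShape s).length :=
    fun s => by rw [exp_log_mul_two_mul (by norm_num : (0 : ℝ) < 2)]; norm_num
  have hnorm : LoopNormLE (Real.log 2) (shapeLoop trailShape) (fun i : Site 4 × TrailShape 4 => c₀ i.2) (143 / 1000) := by
    refine loopNormLE_shapeLoop (Real.log_nonneg (by norm_num)) norm_sub_le_trailShape
      (D₀ := fun s => 2 * ((trailShape s).length : ℝ)) ?_ ?_
    · exact hsum.congr fun s => by rw [hexp]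
    · calc ∑' s, |c₀ s| * ((trailShape s).length : ℝ) ^ 2 * Real.exp (Real.log 2 * (2 * ((trailShape s).length : ℝ)))
          = ∑' s, |c₀ s| * ((trailShape s).length : ℝ) ^ 2 * (4 : ℝ) ^ (trailShape s).length :=
            tsum_congr fun s => by rw [hexp]
        _ ≤ 143 / 1000 := hε
  have hmem := memBallZdS_loopFamilyAction (N := 2)
    (finite_fibre_shapeLoop _ finite_fibre_trailShape length_trailShape_pos) hnorm
  obtain ⟨B, hB⟩ := hmem.summable
  exact oneState_translationInvariant_of_perturbedMassGapAtS (su2_trailShapes_massGapS_1_16 hsum hε) hB hmem.continuous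
    hmem.dependsOn (fun v X U => loopFamilyAction_shapeLoop_shift _ finite_fibre_trailShape length_trailShape_pos c₀ v X U)

/-- ★★ **Every `N ≥ 2`, `ℤ⁴`, 't Hooft `1/64` + all closed-trail shapes translated everywhere,
`∑_s |c₀ s| |s|² (36/25)^{|s|} ≤ 1/40`: ONE DLR STATE, TRANSLATION INVARIANT** (`suN_trailShapes_massGapS_1_64`).
[folklore] -/
theorem suN_trailShapes_oneState_translationInvariant (hN : 2 ≤ N) {c₀ : TrailShape 4 → ℝ}
    (hsum : Summable fun s => |c₀ s| * (trailShape s).length ^ 2 * (36 / 25 : ℝ) ^ (trailShape s).length)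
    (hε : ∑' s, |c₀ s| * (trailShape s).length ^ 2 * (36 / 25 : ℝ) ^ (trailShape s).length ≤ 1 / 40) :
    ∃ μ : Measure (LGConfig 4 (SUN N)),
      perturbedGibbsMeasuresS (d := 4) (fundamentalRep (Fin N)) ((N : ℝ) * (1 / 64))
          (loopFamilyAction (d := 4) N (shapeLoop trailShape) fun i => c₀ i.2) = {μ} ∧ IsZdTranslationInvariant μ := by
  have hexp : ∀ s : TrailShape 4,
      Real.exp (Real.log (6 / 5) * (2 * ((trailShape s).length : ℝ))) = (36 / 25 : ℝ) ^ (trailShape s).length :=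
    fun s => by rw [exp_log_mul_two_mul (by norm_num : (0 : ℝ) < 6 / 5)]; norm_num
  have hnorm : LoopNormLE (Real.log (6 / 5)) (shapeLoop trailShape) (fun i : Site 4 × TrailShape 4 => c₀ i.2) (1 / 40) := by
    refine loopNormLE_shapeLoop (Real.log_nonneg (by norm_num)) norm_sub_le_trailShape
      (D₀ := fun s => 2 * ((trailShape s).length : ℝ)) ?_ ?_
    · exact hsum.congr fun s => by rw [hexp]
    · calc ∑' s, |c₀ s| * ((trailShape s).length : ℝ) ^ 2 * Real.exp (Real.log (6 / 5) * (2 * ((trailShape s).length : ℝ)))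
          = ∑' s, |c₀ s| * ((trailShape s).length : ℝ) ^ 2 * (36 / 25 : ℝ) ^ (trailShape s).length :=
            tsum_congr fun s => by rw [hexp]
        _ ≤ 1 / 40 := hε
  have hmem := memBallZdS_loopFamilyAction (N := N)
    (finite_fibre_shapeLoop _ finite_fibre_trailShape length_trailShape_pos) hnorm
  obtain ⟨B, hB⟩ := hmem.summable
  exact oneState_translationInvariant_of_perturbedMassGapAtS (suN_trailShapes_massGapS_1_64 hN hsum hε) hB
    hmem.continuous hmem.dependsOn
    (fun v X U => loopFamilyAction_shapeLoop_shift _ finite_fibre_trailShape length_trailShape_pos c₀ v X U)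

end Cells

end Summit.Ventures.YMGap.RobustBall

end
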